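import Mathlib.MeasureTheory.Integral.IntervalIntegral.Basic
import Literature.MathematicalPhysics.KineticTheory.LangevinChainKernel
import HarnessLib

/-!
# The `L²(Gibbs)` objects of the equilibrium pinned chain and the odd-sector locality hypothesis

Topic `Literature/MathematicalPhysics/KineticTheory`. For the pinned anharmonic chain
`pinnedChain ω₂ lam β γ` between Langevin baths at the SAME temperature `T` on the two end sites
(the equilibrium base point of linear response), with `P_t = OscillatorChain.transitionKernel N T T t`
the constructed transition kernels (`LangevinChainKernel.lean`), `μ_T = e^{-H_N/T} dq dp` the
UNNORMALISED Gibbs weight, `J = J_tot = ∑_i j_i` the total bond current and `Θ(q,p) = (q,-p)` the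
momentum reversal, this file names the four scalar functions of time through which the
`L²(μ_T)`-theory of the current is expressed —
* `OddSectorLocality.currentNormSq`   `M_N    = ‖J‖²_{L²(μ_T)}`,
* `OddSectorLocality.forecastNormSq`  `A_N(t) = ‖P_tJ‖²_{L²(μ_T)}` (the `L²`-memory of the current),
* `OddSectorLocality.currentAutocorr` `B_N(u) = ⟨J, P_uJ⟩_{L²(μ_T)}` (the unnormalised Green–Kubo integrand),
* `OddSectorLocality.oddPartNormSq`   `F_N(t)² = ‖P_tJ - (P_tJ)∘Θ‖²_{L²(μ_T)}` (norm² of twice the `Θ`-odd part),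
all as plain Bochner integrals against `volume.withDensity e^{-H/T}` of the forecast
`OddSectorLocality.currentForecast t x = ∫ J dP_t(x,·)` — verbatim the expressions of the crux
`OddCorrectorDecay` of route `OddSectorIrreversibility` (summit AtomisticToContinuum / FouriersLaw) —
and records as ONE named fact, `OddSectorLocalityHypothesis`, the standard `L²(μ_T)` dictionary of the
equilibrium chain together with the fixed-time locality ("memory") of the boundary noise, in the weak
form consumed by the negative lemma `oddCorrectorDecay_false_of_oddSectorLocalityHypothesis`
(`Summits/AtomisticToContinuum/FouriersLaw/Theorems/OddCorrectorDecay/Negative/FalseOfLocality.lean`).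

## The dictionary (sources)

1. `μ_T` is invariant under `P_t` at equal bath temperatures (Bonetto–Lebowitz–Rey-Bellet 2000 §4.1;
   Cuneo–Eckmann–Hairer–Rey-Bellet 2018 §3.1, proof of Prop. 3.3: "the measure
   `Z⁻¹e^{-βH}dpdq` is invariant"), so `P_t` is a contraction semigroup on `L²(μ_T)` (Jensen for
   Markov kernels) and `t ↦ A_N(t)` is non-increasing; 2. Cauchy–Schwarz: `B_N(u) ≤ M_N`;
3. generalised detailed balance `P_t* = ΘP_tΘ` on `L²(μ_T)` — the generator satisfies `L† = ΘLΘ`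
   (the Liouville part is antisymmetric and `Θ`-odd, the two Ornstein–Uhlenbeck parts symmetric and
   `Θ`-even; Kundu–Dhar–Narayan 2009 eq. (reln2); Eckmann–Pillet–Rey-Bellet 1999; Maes–Netočný 2010)
   — which with the `Θ`-invariance of `μ_T` and `J∘Θ = -J` gives the odd-norm identity
   `F_N(t)² = 2A_N(t) + 2B_N(2t)` (`⟨P_tJ, ΘP_tJ⟩ = ⟨J, ΘP_{2t}J⟩ = -B_N(2t)`);
4. the stationary autocovariance `u ↦ B_N(|u|)` is positive-definite (Markov property + invariance),
   in Fejér form `∫₀^S (S-u)B_N(u)du = ½·Z·E(∫₀^S J(X_s)ds)² ≥ 0`.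
MEMORY (5): `M_N - A_N(t) = E_μ Var(J(X_t) | X_0) = 2γT∫₀ᵗ ∑_{b∈{0,N-1}} ‖∂_{p_b}P_sJ‖²_{L²(μ_T)} ds`
(the `L²(μ_T)` dissipation identity: only the two bath directions dissipate, the deterministic bulk
is `L²(μ_T)`-unitary), and the sensitivity of the forecast `P_sJ = ∑_z P_s j_z` to a boundary
momentum is carried by the bonds reached by the perturbation within time `s` — finite propagation
speed of perturbations in anharmonic lattices for Gibbs-typical data (Marchioro–Pellegrinotti–
Pulvirenti–Triolo 1978; Buttà–Caglioti–Di Ruzza–Marchioro 2007) — so `M_N - A_N(t) = O_t(1)·N^{o(1)}`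
while `M_N ≍ N`, i.e. `A_N(t)/M_N → 1` as `N → ∞` at fixed `t`; recorded in the weak form
`∀ S > 0 ∃ N, 0 < M_N ≤ 2A_N(S)`.

## What is proved here / what is not

Proved: `currentForecast_zero` (`P_0 = id`, from `pinnedChain_transitionKernel_zero`) and
`forecastNormSq_zero` (`A_N(0) = M_N`). NOT here (hence the named fact): invariance of `μ_T` under the
constructed kernels (the tree has weak stationarity `∫Lf dμ_T = 0`, `LangevinChainGibbs.lean`, not the
semigroup statement), the `Θ`-detailed balance (the tree has the Lebesgue duality of
`LangevinChainReversal.lean` for `langevinKernel` only), the Markov/Fubini argument for (4), and the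
propagation estimate for (5).

## References

* F. Bonetto, J. L. Lebowitz, L. Rey-Bellet, *Fourier's law: a challenge to theorists* (2000), §4.1.
* N. Cuneo, J.-P. Eckmann, M. Hairer, L. Rey-Bellet, EJP 23 (2018) no. 55, §3.1.
* A. Kundu, A. Dhar, O. Narayan, J. Stat. Mech. (2009) L03001, arXiv:0809.4543, eqs. (reln2)–(reln3).
* C. Marchioro, A. Pellegrinotti, M. Pulvirenti, L. Triolo, J. Stat. Phys. 19 (1978) 499–510.
* P. Buttà, E. Caglioti, S. Di Ruzza, C. Marchioro, J. Stat. Phys. 127 (2007) 313–325.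
-/

noncomputable section

open _root_.MeasureTheory Set intervalIntegral

namespace Literature.MathematicalPhysics.KineticTheory

open HeatConduction

namespace OddSectorLocality

section Objects

variable (ω₂ lam β γ T : ℝ) (N : ℕ)

/-- The unnormalised Gibbs weight `μ_T = e^{-H_N/T} dq dp` of `pinnedChain ω₂ lam β γ` (finite mass for
`ω₂ > 0`, `lam, β ≥ 0`, `T > 0`; written `(-H)/T` exactly as in the crux `OddCorrectorDecay`).
[folklore] -/
def gibbsWeight : Measure (PhaseSpace N) :=
  volume.withDensity (fun x : PhaseSpace N =>
    ENNReal.ofReal (Real.exp (-((pinnedChain ω₂ lam β γ).hamiltonian N x) / T)))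

/-- The forecast of the total current under the EQUILIBRIUM kernels (both baths at `T`),
`P_t J_tot (x) = ∫ J_tot dP_t(x,·)`, time clamped to `ℝ≥0` by `Real.toNNReal`. [folklore] -/
def currentForecast (t : ℝ) (x : PhaseSpace N) : ℝ :=
  ∫ y, (∑ i : Fin N, (pinnedChain ω₂ lam β γ).bondCurrent N i y)
    ∂((pinnedChain ω₂ lam β γ).transitionKernel N T T t.toNNReal x)

/-- `F_N(t)² = ‖P_tJ - (P_tJ)∘Θ‖²_{L²(μ_T)}`, `Θ(q,p) = (q,-p)`: the squared `L²(μ_T)`-norm of twice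
the momentum-reversal-odd part of the forecast. [folklore] -/
def oddPartNormSq (t : ℝ) : ℝ :=
  ∫ x, ((currentForecast ω₂ lam β γ T N t x) -
    (currentForecast ω₂ lam β γ T N t (x.1, -x.2))) ^ 2 ∂(gibbsWeight ω₂ lam β γ T N)

/-- `M_N = ‖J_tot‖²_{L²(μ_T)}`. [folklore] -/
def currentNormSq : ℝ :=
  ∫ x, (∑ i : Fin N, (pinnedChain ω₂ lam β γ).bondCurrent N i x) ^ 2 ∂(gibbsWeight ω₂ lam β γ T N)

/-- `A_N(t) = ‖P_tJ_tot‖²_{L²(μ_T)}`, the `L²(μ_T)`-memory of the total current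
(`M_N - A_N(t) = E_μ Var(J(X_t) | X_0)` under invariance). [folklore] -/
def forecastNormSq (t : ℝ) : ℝ :=
  ∫ x, (currentForecast ω₂ lam β γ T N t x) ^ 2 ∂(gibbsWeight ω₂ lam β γ T N)

/-- `B_N(u) = ⟨J_tot, P_uJ_tot⟩_{L²(μ_T)}`, the unnormalised equilibrium current autocorrelation
(Green–Kubo integrand; Kundu–Dhar–Narayan 2009 eq. (reln3)). [folklore] -/
def currentAutocorr (u : ℝ) : ℝ :=
  ∫ x, (∑ i : Fin N, (pinnedChain ω₂ lam β γ).bondCurrent N i x) *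
    currentForecast ω₂ lam β γ T N u x ∂(gibbsWeight ω₂ lam β γ T N)

end Objects

/-- `P_0 = id`: the forecast at time `0` is the current itself (`pinnedChain_transitionKernel_zero`).
[folklore] -/
theorem currentForecast_zero {ω₂ lam β γ : ℝ} (hω : 0 < ω₂) (hl : 0 ≤ lam) (hβ : 0 ≤ β)
    (hγ : 0 ≤ γ) (T : ℝ) (N : ℕ) (x : PhaseSpace N) :
    currentForecast ω₂ lam β γ T N 0 x = ∑ i : Fin N, (pinnedChain ω₂ lam β γ).bondCurrent N i x := by
  unfold currentForecast
  rw [Real.toNNReal_zero, pinnedChain_transitionKernel_zero hω hl hβ hγ N T T,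
    ProbabilityTheory.Kernel.id_apply, integral_dirac]

/-- `A_N(0) = M_N`. [folklore] -/
theorem forecastNormSq_zero {ω₂ lam β γ : ℝ} (hω : 0 < ω₂) (hl : 0 ≤ lam) (hβ : 0 ≤ β)
    (hγ : 0 ≤ γ) (T : ℝ) (N : ℕ) :
    forecastNormSq ω₂ lam β γ T N 0 = currentNormSq ω₂ lam β γ T N := by
  unfold forecastNormSq currentNormSq
  simp_rw [currentForecast_zero hω hl hβ hγ]

end OddSectorLocality

open OddSectorLocality in
/-- **The odd-sector locality hypothesis** (named fact; the `L²(μ_T)` dictionary of the equilibrium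
pinned chain + fixed-time memory of the total current, at SOME admissible parameter point — expected
at every point with `ω₂, lam, β, γ, T > 0`). With `M_N`, `A_N`, `B_N`, `F_N²` as in this file, there
are `ω₂, lam, β, γ, T > 0` such that for every `N`:
(1) `t ↦ A_N(t)` is non-increasing on `[0,∞)` (`μ_T` is `P_t`-invariant at equal temperatures —
Bonetto–Lebowitz–Rey-Bellet 2000 §4.1, Cuneo–Eckmann–Hairer–Rey-Bellet 2018 §3.1 — hence `P_t`
contracts `L²(μ_T)`); (2) `B_N(u) ≤ M_N` for `u ≥ 0` (Cauchy–Schwarz); (3) the odd-norm identity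
`F_N(t)² = 2A_N(t) + 2B_N(2t)` for `t ≥ 0` (`Θ`-invariance of `μ_T`, `J∘Θ = -J`, generalised
detailed balance `P_t* = ΘP_tΘ`, i.e. `L† = ΘLΘ`, Kundu–Dhar–Narayan 2009 eq. (reln2));
(4) Fejér positivity of the stationary autocovariance, `0 ≤ ∫₀^S (S-u)B_N(u)du` for `S > 0`;
and (5) MEMORY: for every horizon `S > 0` some length `N` has `0 < M_N ≤ 2A_N(S)` — the weak form
of `A_N(S)/M_N → 1` (`N → ∞`), from the dissipation identity
`M_N - A_N(S) = 2γT∫₀^S∑_b‖∂_{p_b}P_sJ‖²ds` and the finite propagation speed of perturbations in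
anharmonic lattices (Marchioro–Pellegrinotti–Pulvirenti–Triolo 1978; Buttà–Caglioti–Di Ruzza–
Marchioro 2007). A conjunction of standard facts, none yet constructible in the tree; it implies
`¬ OddCorrectorDecay` (route OddSectorIrreversibility). [folklore] -/
def OddSectorLocalityHypothesis : Prop :=
  ∃ ω₂ lam β γ T : ℝ, 0 < ω₂ ∧ 0 < lam ∧ 0 < β ∧ 0 < γ ∧ 0 < T ∧
    (∀ N : ℕ,
      AntitoneOn (forecastNormSq ω₂ lam β γ T N) (Ici 0) ∧
      (∀ u : ℝ, 0 ≤ u → currentAutocorr ω₂ lam β γ T N u ≤ currentNormSq ω₂ lam β γ T N) ∧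
      (∀ t : ℝ, 0 ≤ t → oddPartNormSq ω₂ lam β γ T N t =
        2 * forecastNormSq ω₂ lam β γ T N t + 2 * currentAutocorr ω₂ lam β γ T N (2 * t)) ∧
      (∀ S : ℝ, 0 < S → 0 ≤ ∫ u in (0:ℝ)..S, (S - u) * currentAutocorr ω₂ lam β γ T N u)) ∧
    (∀ S : ℝ, 0 < S → ∃ N : ℕ, 0 < currentNormSq ω₂ lam β γ T N ∧
      currentNormSq ω₂ lam β γ T N ≤ 2 * forecastNormSq ω₂ lam β γ T N S)

end Literature.MathematicalPhysics.KineticTheory
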